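import Literature.MathematicalPhysics.QuantumLattice.KomaPiFluxDoubleCommutator
import HarnessLib

/-!
# The sum rules for the `Γ¹`-modes (Koma 2022, (6.17)–(6.20)) — Plancherel on the fermion torus

T. Koma, *Nambu–Goldstone modes for superconducting lattice fermions*, arXiv:2201.13135 (2022)
[Koma2022], §6, step (6.17)–(6.20): with `Γ̂¹_p = |Λ|^{-1/2} Σ_x Γ¹_x e^{-ipx}` (6.10), the thermal
structure factor `⟨Γ̂¹_pΓ̂¹_{-p}⟩` satisfies the Kennedy–Lieb–Shastry sum rule
`-(1/d|Λ|) Σ_p Σ_i ⟨Γ̂¹_pΓ̂¹_{-p}⟩ cos pᵢ = -(1/2|Λ|) Σ_x ⟨Γ¹_xΓ¹_{x-e₁} + Γ¹_xΓ¹_{x+e₁}⟩` (6.20), and the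
`p = Q` term is the long-range order `(m_LRO)² = |Λ|⁻¹⟨Γ̂¹_QΓ̂¹_Q⟩ = |Λ|⁻² Σ_{x,y} (-1)^{x+y}⟨Γ¹_xΓ¹_y⟩`
(6.18)–(6.19).

Here, in the Lieb frame of this series (the sublattice rotation (6.5) is built in, so `Q ↦ 0` and
the signs `(-1)^x` disappear) and with the real modes `C_p = Γ¹[cos(p·)]`, `S_p = Γ¹[sin(p·)]` of
`KomaPiFluxInfraredBound.lean` (so that `⟨C_p²⟩ + ⟨S_p²⟩ = Σ_{x,y} cos(p·(x-y)) ⟨Γ¹_xΓ¹_y⟩`, the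
un-normalised `|Λ|·g_p` of (6.13)), we PROVE:

* `KomaPiFlux.pairCorr β H x y = Re⟨Γ¹_xΓ¹_y⟩`, symmetric (`Γ¹`'s commute);
* `KomaPiFlux.re_gibbs_modes_eq` — `⟨C_p²⟩ + ⟨S_p²⟩ = Σ_{x,y} cos(p·(x̄-ȳ)) pairCorr x y`;
* `KomaPiFlux.modes_sumRule` — `Σ_p (⟨C_p²⟩ + ⟨S_p²⟩) = L^{d+1} Σ_x ⟨(Γ¹_x)²⟩` (Plancherel);
* `KomaPiFlux.modes_weightedSumRule` — `Σ_p (⟨C_p²⟩ + ⟨S_p²⟩) cos pᵢ = L^{d+1} Σ_x ⟨Γ¹_xΓ¹_{x+eᵢ}⟩`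
  ((6.20), through the tree's `sum_structureFactor_mul_cos`);
* `KomaPiFlux.lroSq` — `m² = |Λ|⁻² Σ_{x,y} ⟨Γ¹_xΓ¹_y⟩ = ⟨C_0²⟩/|Λ|²` ((6.18)–(6.19)).

No named fact.

## References

* [Koma2022] T. Koma, arXiv:2201.13135, (6.10), (6.13), (6.17)–(6.20).
* [KLS1988PRL] T. Kennedy, E. H. Lieb, B. S. Shastry, Phys. Rev. Lett. 61 (1988) 2582, eqs. (3), (6).
-/

noncomputable section

namespace Literature.MathematicalPhysics.QuantumLattice

open Matrix Finset HubbardWave0 PairHopRP FermionTorus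
open Literature.Probability.LatticeModels

namespace KomaPiFlux

attribute [local instance] LiebCutRP.decEqTorus

variable {d L : ℕ} [NeZero L]

/-! ### The pair correlation kernel -/

/-- The thermal `η`-pair correlation `Re ⟨Γ¹_x Γ¹_y⟩_{β,H}`. [cite: Koma2022, (6.13), (6.18)] -/
def pairCorr (β : ℝ) (H : Matrix (Finset (Orb (FermionTorus (d + 1) L))) (Finset (Orb (FermionTorus (d + 1) L))) ℂ)
    (x y : FermionTorus (d + 1) L) : ℝ :=
  (gibbsState β H (gammaOne x * gammaOne y)).re

omit [NeZero L] in
/-- The pair correlation kernel is symmetric (`Γ¹_x` and `Γ¹_y` commute). [cite: Koma2022, §3] -/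
theorem pairCorr_symm (β : ℝ)
    (H : Matrix (Finset (Orb (FermionTorus (d + 1) L))) (Finset (Orb (FermionTorus (d + 1) L))) ℂ)
    (x y : FermionTorus (d + 1) L) : pairCorr β H x y = pairCorr β H y x := by
  rw [pairCorr, pairCorr, gammaOne_comm]

omit [NeZero L] in
/-- `Γ¹[c] Γ¹[c'] = Σ_{x,y} c(x)c'(y) Γ¹_xΓ¹_y`. [cite: Koma2022, (6.10)] -/
theorem gammaOneMode_mul (c c' : FermionTorus (d + 1) L → ℝ) :
    gammaOneMode c * gammaOneMode c' =
      ∑ x : FermionTorus (d + 1) L, ∑ y : FermionTorus (d + 1) L, ((c x * c' y : ℝ) : ℂ) • (gammaOne x * gammaOne y) := by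
  unfold gammaOneMode
  rw [Finset.sum_mul]
  refine Finset.sum_congr rfl fun x _ => ?_
  rw [Finset.mul_sum]
  refine Finset.sum_congr rfl fun y _ => ?_
  rw [Matrix.smul_mul, Matrix.mul_smul, smul_smul, Complex.ofReal_mul]

omit [NeZero L] in
/-- `Re⟨Γ¹[c] Γ¹[c']⟩ = Σ_{x,y} c(x)c'(y) Re⟨Γ¹_xΓ¹_y⟩`. [cite: Koma2022, (6.10), (6.13)] -/
theorem re_gibbsState_gammaOneMode_mul (β : ℝ)
    (H : Matrix (Finset (Orb (FermionTorus (d + 1) L))) (Finset (Orb (FermionTorus (d + 1) L))) ℂ)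
    (c c' : FermionTorus (d + 1) L → ℝ) :
    (gibbsState β H (gammaOneMode c * gammaOneMode c')).re =
      ∑ x : FermionTorus (d + 1) L, ∑ y : FermionTorus (d + 1) L, c x * c' y * pairCorr β H x y := by
  rw [gammaOneMode_mul, map_sum, Complex.re_sum]
  refine Finset.sum_congr rfl fun x _ => ?_
  rw [map_sum, Complex.re_sum]
  refine Finset.sum_congr rfl fun y _ => ?_
  rw [map_smul, smul_eq_mul, Complex.re_ofReal_mul, pairCorr]

/-- **The structure factor of the real modes**: `⟨C_p²⟩ + ⟨S_p²⟩ = Σ_{x,y} cos(p·(x̄-ȳ)) Re⟨Γ¹_xΓ¹_y⟩`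
(`= |Λ| g_p` of (6.13) in the Lieb frame). [cite: Koma2022, (6.10), (6.13)] -/
theorem re_gibbs_modes_eq (β : ℝ)
    (H : Matrix (Finset (Orb (FermionTorus (d + 1) L))) (Finset (Orb (FermionTorus (d + 1) L))) ℂ)
    (p : TorusSite (d + 1) L) :
    (gibbsState β H (gammaOneMode (cosWave p) * gammaOneMode (cosWave p))).re +
        (gibbsState β H (gammaOneMode (sinWave p) * gammaOneMode (sinWave p))).re =
      ∑ x : FermionTorus (d + 1) L, ∑ y : FermionTorus (d + 1) L,
        Real.cos (torusPhase L p (toTorusSite x - toTorusSite y)) * pairCorr β H x y := by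
  rw [re_gibbsState_gammaOneMode_mul, re_gibbsState_gammaOneMode_mul, ← Finset.sum_add_distrib]
  refine Finset.sum_congr rfl fun x _ => ?_
  rw [← Finset.sum_add_distrib]
  refine Finset.sum_congr rfl fun y _ => ?_
  rw [cosWave, cosWave, sinWave, sinWave, cos_torusPhase_sub L]
  ring

/-! ### Plancherel and the KLS weighted sum rule -/

/-- **Plancherel**: `Σ_p (⟨C_p²⟩ + ⟨S_p²⟩) = L^{d+1} Σ_x ⟨(Γ¹_x)²⟩`. [cite: Koma2022, (6.10), (6.17)] -/
theorem modes_sumRule (β : ℝ)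
    (H : Matrix (Finset (Orb (FermionTorus (d + 1) L))) (Finset (Orb (FermionTorus (d + 1) L))) ℂ) :
    ∑ p : TorusSite (d + 1) L,
        ((gibbsState β H (gammaOneMode (cosWave p) * gammaOneMode (cosWave p))).re +
          (gibbsState β H (gammaOneMode (sinWave p) * gammaOneMode (sinWave p))).re) =
      (L : ℝ) ^ (d + 1) * ∑ x : FermionTorus (d + 1) L, pairCorr β H x x := by
  simp_rw [re_gibbs_modes_eq]
  rw [Finset.sum_comm, Finset.mul_sum]
  refine Finset.sum_congr rfl fun x _ => ?_
  rw [Finset.sum_comm]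
  simp_rw [← Finset.sum_mul, sum_cos_torusPhase, sub_eq_zero, ite_mul, zero_mul]
  rw [Finset.sum_eq_single x (fun y _ hyx => if_neg (fun h => hyx (toTorusSite_injective h).symm))
    (fun h => absurd (Finset.mem_univ x) h), if_pos rfl]

/-- **The KLS weighted sum rule, (6.20) in the Lieb frame**:
`Σ_p (⟨C_p²⟩ + ⟨S_p²⟩) cos pᵢ = L^{d+1} Σ_x Re⟨Γ¹_x Γ¹_{x+eᵢ}⟩` (the nearest-neighbour `η`-pair
correlation; Koma's sign `-` and momentum shift `Q` are absorbed by the sublattice rotation (6.5)).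
[cite: Koma2022, (6.20)] [cite: KLS1988PRL, eqs. (3), (6)] -/
theorem modes_weightedSumRule (β : ℝ)
    (H : Matrix (Finset (Orb (FermionTorus (d + 1) L))) (Finset (Orb (FermionTorus (d + 1) L))) ℂ)
    (i : Fin (d + 1)) :
    ∑ p : TorusSite (d + 1) L,
        ((gibbsState β H (gammaOneMode (cosWave p) * gammaOneMode (cosWave p))).re +
            (gibbsState β H (gammaOneMode (sinWave p) * gammaOneMode (sinWave p))).re) *
          Real.cos (latticeMomentum L p i) =
      (L : ℝ) ^ (d + 1) * ∑ x : FermionTorus (d + 1) L, pairCorr β H x (shift x i) := by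
  simp_rw [re_gibbs_modes_eq]
  set e := (FermionTorus.equivTorusSite : FermionTorus (d + 1) L ≃ TorusSite (d + 1) L) with he
  have hex : ∀ x : FermionTorus (d + 1) L, e x = toTorusSite x := fun _ => rfl
  -- reindex the site sums over `(ZMod L)^{d+1}`
  have hxy : ∀ p : TorusSite (d + 1) L,
      ∑ x : FermionTorus (d + 1) L, ∑ y : FermionTorus (d + 1) L,
          Real.cos (torusPhase L p (toTorusSite x - toTorusSite y)) * pairCorr β H x y =
        ∑ u : TorusSite (d + 1) L, ∑ v : TorusSite (d + 1) L,
          Real.cos (torusPhase L p (u - v)) * pairCorr β H (e.symm u) (e.symm v) := by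
    intro p
    rw [← e.sum_comp]
    refine Finset.sum_congr rfl fun x _ => ?_
    rw [← e.sum_comp]
    refine Finset.sum_congr rfl fun y _ => ?_
    rw [e.symm_apply_apply, e.symm_apply_apply, hex, hex]
  simp_rw [hxy]
  rw [sum_structureFactor_mul_cos L (fun u v => pairCorr β H (e.symm u) (e.symm v))
    (fun u v => pairCorr_symm β H _ _) i]
  congr 1
  rw [← e.sum_comp]
  refine Finset.sum_congr rfl fun x _ => ?_
  rw [e.symm_apply_apply, hex, ← toTorusSite_shift, ← hex, e.symm_apply_apply]

/-! ### The long-range order (6.18)–(6.19) -/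

/-- **The (squared) long-range order parameter**, Lieb frame:
`m² = |Λ|⁻² Σ_{x,y} Re⟨Γ¹_xΓ¹_y⟩` (Koma's (6.18) carries the staggering `(-1)^{x+y}`, removed here
by the sublattice rotation (6.5)). [cite: Koma2022, (6.18)] -/
def lroSq (β : ℝ)
    (H : Matrix (Finset (Orb (FermionTorus (d + 1) L))) (Finset (Orb (FermionTorus (d + 1) L))) ℂ) : ℝ :=
  (∑ x : FermionTorus (d + 1) L, ∑ y : FermionTorus (d + 1) L, pairCorr β H x y) /
    (Fintype.card (FermionTorus (d + 1) L) : ℝ) ^ 2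

omit [NeZero L] in
/-- `⟨C_0²⟩ = Σ_{x,y} Re⟨Γ¹_xΓ¹_y⟩` (the zero mode is the total `η¹`-spin). [cite: Koma2022, (6.19)] -/
theorem re_gibbsState_modeZero_sq (β : ℝ)
    (H : Matrix (Finset (Orb (FermionTorus (d + 1) L))) (Finset (Orb (FermionTorus (d + 1) L))) ℂ) :
    (gibbsState β H (gammaOneMode (cosWave (0 : TorusSite (d + 1) L)) *
        gammaOneMode (cosWave (0 : TorusSite (d + 1) L)))).re =
      ∑ x : FermionTorus (d + 1) L, ∑ y : FermionTorus (d + 1) L, pairCorr β H x y := by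
  rw [re_gibbsState_gammaOneMode_mul]
  simp only [cosWave, torusPhase_zero_left, Real.cos_zero, one_mul]

omit [NeZero L] in
/-- The sine zero-mode vanishes: `S_0 = 0`. [cite: Koma2022, (6.10)] -/
theorem gammaOneMode_sinWave_zero : gammaOneMode (sinWave (0 : TorusSite (d + 1) L)) = 0 := by
  unfold gammaOneMode
  simp only [sinWave, torusPhase_zero_left, Real.sin_zero, Complex.ofReal_zero, zero_smul, Finset.sum_const_zero]

omit [NeZero L] in
/-- **(6.19)**: `m² = ⟨C_0²⟩ / |Λ|²`. [cite: Koma2022, (6.19)] -/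
theorem lroSq_eq (β : ℝ)
    (H : Matrix (Finset (Orb (FermionTorus (d + 1) L))) (Finset (Orb (FermionTorus (d + 1) L))) ℂ) :
    lroSq β H = (gibbsState β H (gammaOneMode (cosWave (0 : TorusSite (d + 1) L)) *
        gammaOneMode (cosWave (0 : TorusSite (d + 1) L)))).re /
      (Fintype.card (FermionTorus (d + 1) L) : ℝ) ^ 2 := by
  rw [lroSq, re_gibbsState_modeZero_sq]

/-- **The sum rule split at `p = 0`** (the form used in (6.17)): for any weights `w`,
`Σ_{p ≠ 0} (⟨C_p²⟩ + ⟨S_p²⟩) w_p + |Λ|² m² w_0 = Σ_p (⟨C_p²⟩ + ⟨S_p²⟩) w_p`. [cite: Koma2022, (6.17)] -/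
theorem modes_sum_split (β : ℝ)
    (H : Matrix (Finset (Orb (FermionTorus (d + 1) L))) (Finset (Orb (FermionTorus (d + 1) L))) ℂ)
    (w : TorusSite (d + 1) L → ℝ) :
    ∑ p ∈ (Finset.univ : Finset (TorusSite (d + 1) L)).erase 0,
        ((gibbsState β H (gammaOneMode (cosWave p) * gammaOneMode (cosWave p))).re +
            (gibbsState β H (gammaOneMode (sinWave p) * gammaOneMode (sinWave p))).re) * w p +
      (Fintype.card (FermionTorus (d + 1) L) : ℝ) ^ 2 * lroSq β H * w 0 =
    ∑ p : TorusSite (d + 1) L,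
        ((gibbsState β H (gammaOneMode (cosWave p) * gammaOneMode (cosWave p))).re +
            (gibbsState β H (gammaOneMode (sinWave p) * gammaOneMode (sinWave p))).re) * w p := by
  have hcard : (Fintype.card (FermionTorus (d + 1) L) : ℝ) ≠ 0 := by
    have : 0 < Fintype.card (FermionTorus (d + 1) L) := Fintype.card_pos
    exact_mod_cast this.ne'
  rw [← Finset.add_sum_erase _ _ (Finset.mem_univ (0 : TorusSite (d + 1) L)), add_comm, lroSq_eq,
    gammaOneMode_sinWave_zero, Matrix.mul_zero, map_zero, Complex.zero_re, add_zero, mul_div_cancel₀ _ (pow_ne_zero 2 hcard)]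

end KomaPiFlux

end Literature.MathematicalPhysics.QuantumLattice

end
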